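import Literature.NumberTheory.Automorphic.QuadraticOrderUnitIndex
import HarnessLib

/-!
# Lattices of `ℚ(γ)` and idele classes: `h(B) = #{locally principal B-lattices}/ℚ(γ)ˣ`

Topic `NumberTheory/Automorphic`; definitions with bodies and theorems (no named fact, no
`sorry`). Eighth brick of the Brandt-module side of the Eichler–Pizer trace identity: the first
half of the identification of the idelic class number `classNumber γ B` of an order `B` of the
imaginary quadratic field `ℚ(γ)` (inside a division quaternion algebra `D`) with the form class
number — the passage from idele classes to classes of lattices (Vignéras III §5, proof of
Thm. 5.11 read inside `L = ℚ(γ)`; Cox §7.A–C: `Pic(𝒪) = I(𝒪)/P(𝒪)` with Prop. 7.4).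

* `IsKLattice γ L` — `L` is a full `ℤ`-lattice of `ℚ(γ)`; `IsLocPrin γ B L` — `L_(p) = x_p B_(p)`
  with `x_p ∈ ℚ(γ)ˣ` for every prime `p` (locally principal `B`-lattices).
* `exists_glue_K` — gluing inside `ℚ(γ)`; `latticeOf k` — the lattice `L(k)` of an idele `k`
  (`L(k)_(p) = k_p B_(p)`, `localAt_latticeOf`).
* `LatClass γ B` — locally principal `B`-lattices modulo `ℚ(γ)ˣ`, and
  `ideleClassEquivLatClass : IdeleClass γ B ≃ LatClass γ B`, `classNumber_eq_card_latClass`.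

## References

* M.-F. Vignéras, *Arithmétique des algèbres de quaternions*, LNM 800 (1980), Ch. III §5,
  Prop. 5.1 and proof of Thm. 5.11 [VignerasLNM800].
* D. A. Cox, *Primes of the form x² + ny²*, 2nd ed. (2013), §7.A Prop. 7.4, §7.C [Cox2013].
-/

noncomputable section

open scoped Pointwise

universe u

namespace Literature.NumberTheory.Automorphic

namespace Brandt

variable {D : Type u} [Ring D] [Algebra ℚ D] [IsQuaternionAlgebra ℚ D] {γ : D} {B : Submodule ℤ D}

/-! ### Lattices of `ℚ(γ)` -/

/-- **A full `ℤ`-lattice of `ℚ(γ)`**: finitely generated, contained in `ℚ(γ)`, and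
`ℚ L = ℚ(γ)`. [cite: Cox2013, §7.A] -/
structure IsKLattice (γ : D) (L : Submodule ℤ D) : Prop where
  /-- `L` is finitely generated. -/
  fg : L.FG
  /-- `L ⊆ ℚ(γ)`. -/
  le_adjoin : L ≤ adjoinLattice γ
  /-- `ℚ L = ℚ(γ)`. -/
  full : ∀ z ∈ adjoinLattice γ, ∃ m : ℤ, m ≠ 0 ∧ m • z ∈ L

omit [IsQuaternionAlgebra ℚ D] in
/-- An order of `ℚ(γ)` is a lattice of `ℚ(γ)`. [folklore] -/
theorem IsQuadOrder.isKLattice (h : IsQuadOrder γ B) : IsKLattice γ B := ⟨h.fg, h.le_adjoin, h.full⟩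

omit [IsQuaternionAlgebra ℚ D] in
/-- `ℚ(γ)` (as a `ℤ`-module) is stable under left multiplication by `ℚ(γ)`. [folklore] -/
theorem mul_mem_adjoinLattice {x y : D} (hx : x ∈ Algebra.adjoin ℚ {γ}) (hy : y ∈ adjoinLattice γ) :
    x * y ∈ adjoinLattice γ :=
  Subalgebra.mul_mem _ hx hy

omit [IsQuaternionAlgebra ℚ D] in
/-- `ℚ(γ)` is divisible: `m z ∈ ℚ(γ)`, `m ≠ 0` imply `z ∈ ℚ(γ)`. [folklore] -/
theorem mem_adjoinLattice_of_smul_mem {z : D} {m : ℤ} (hm : m ≠ 0) (h : m • z ∈ adjoinLattice γ) :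
    z ∈ adjoinLattice γ := by
  have : z = (m : ℚ)⁻¹ • (m • z) := by
    rw [← Int.cast_smul_eq_zsmul ℚ, smul_smul, inv_mul_cancel₀ (by exact_mod_cast hm), one_smul]
  rw [this]
  exact Subalgebra.smul_mem _ h _

omit [IsQuaternionAlgebra ℚ D] [Algebra ℚ D] in
/-- `c • L` is finitely generated if `L` is. [folklore] -/
theorem fg_units_smul {L : Submodule ℤ D} (hL : L.FG) (c : Dˣ) : (c • L).FG := by
  classical
  obtain ⟨s, hs⟩ := hL
  refine ⟨s.image fun x => (c : D) * x, ?_⟩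
  rw [Finset.coe_image, ← hs, Units.smul_def, Submodule.smul_span]
  congr 1

/-- **Translates of lattices by `ℚ(γ)ˣ` are lattices.** [folklore] -/
theorem IsKLattice.units_smul (hD : ∀ x : D, x ≠ 0 → IsUnit x) (hγ : γ ∉ (⊥ : Subalgebra ℚ D))
    {L : Submodule ℤ D} (hL : IsKLattice γ L) {c : Dˣ} (hc : (c : D) * γ = γ * c) :
    IsKLattice γ (c • L) := by
  have hcadj : (c : D) ∈ Algebra.adjoin ℚ {γ} := mem_adjoin_of_comm hD hγ hc
  have hcadj' : ((c⁻¹ : Dˣ) : D) ∈ Algebra.adjoin ℚ {γ} := mem_adjoin_of_comm hD hγ (units_inv_comm hc)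
  refine ⟨fg_units_smul hL.fg c, ?_, fun z hz => ?_⟩
  · intro x hx
    rw [mem_units_smul_submodule_iff] at hx
    have := mul_mem_adjoinLattice hcadj (hL.le_adjoin hx)
    rwa [Units.smul_def, smul_eq_mul, ← mul_assoc, Units.mul_inv, one_mul] at this
  · obtain ⟨m, hm0, hm⟩ := hL.full _ (mul_mem_adjoinLattice hcadj' hz)
    refine ⟨m, hm0, ?_⟩
    rw [mem_units_smul_submodule_iff, Units.smul_def, smul_comm]
    exact hm

omit [IsQuaternionAlgebra ℚ D] in
/-- **Commensurability in `p`-power form inside `ℚ(γ)`**: `p^r L ⊆ M_(p)` for a finitely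
generated `L ⊆ ℚ(γ)` and a lattice `M` of `ℚ(γ)`. [folklore] -/
theorem exists_pow_smul_mem_localAt_K {p : ℕ} (hp : p.Prime) {L M : Submodule ℤ D} (hL : L.FG)
    (hLle : L ≤ adjoinLattice γ) (hM : IsKLattice γ M) :
    ∃ r : ℕ, ∀ x ∈ L, ((p : ℤ) ^ r) • x ∈ localAt p M := by
  obtain ⟨N, hN0, hNL⟩ := IsQuadOrder.exists_nat_smul_mem_of_full hM.full hL hLle
  refine ⟨N.factorization p, fun x hx => ?_⟩
  set m : ℕ := N / p ^ N.factorization p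
  have hm0 : m ≠ 0 := (Nat.div_pos (Nat.ordProj_le p hN0) (Nat.ordProj_pos N p)).ne'
  have hmcop : m.Coprime p := (Nat.coprime_ordCompl hp hN0).symm
  refine mem_localAt_of_smul_mem hm0 hmcop ?_
  rw [smul_smul, ← Nat.cast_pow, ← Nat.cast_mul, Nat.mul_comm, Nat.ordProj_mul_ordCompl_eq_self]
  exact hNL x hx

omit [IsQuaternionAlgebra ℚ D] in
/-- A module squeezed `p^r L ⊆ M`, `p^r M ⊆ L` around a lattice `L` of `ℚ(γ)` is a lattice of
`ℚ(γ)`. [folklore] -/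
theorem isKLattice_of_pow_smul {p : ℕ} (hp : p.Prime) {L M : Submodule ℤ D} (hL : IsKLattice γ L)
    (r : ℕ) (hLM : ∀ x ∈ L, ((p : ℤ) ^ r) • x ∈ M) (hML : ∀ x ∈ M, ((p : ℤ) ^ r) • x ∈ L) :
    IsKLattice γ M := by
  have hpr : ((p : ℤ) ^ r) ≠ 0 := pow_ne_zero r (by exact_mod_cast hp.ne_zero)
  refine ⟨?_, fun x hx => ?_, fun z hz => ?_⟩
  · let f : D →ₗ[ℤ] D := ((LinearMap.lsmul ℚ D ((p : ℚ) ^ r)⁻¹)).restrictScalars ℤ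
    refine Submodule.FG.of_le (hL.1.map f) fun x hx => ?_
    refine ⟨((p : ℤ) ^ r) • x, hML x hx, ?_⟩
    simp only [f, LinearMap.coe_restrictScalars, LinearMap.lsmul_apply]
    rw [← Int.cast_smul_eq_zsmul ℚ, smul_smul]
    push_cast
    rw [inv_mul_cancel₀ (pow_ne_zero r (by exact_mod_cast hp.ne_zero)), one_smul]
  · exact mem_adjoinLattice_of_smul_mem hpr (hL.le_adjoin (hML x hx))
  · obtain ⟨n, hn, hnz⟩ := hL.full z hz
    exact ⟨(p : ℤ) ^ r * n, mul_ne_zero hpr hn, by rw [mul_smul]; exact hLM _ hnz⟩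

/-! ### Gluing inside `ℚ(γ)` -/

/-- **Gluing inside `ℚ(γ)`** (Vignéras III §5 Prop. 5.1 for the commutative algebra `ℚ(γ)`):
for an order `B` of `ℚ(γ)`, a finite set `S` of primes and `x_q ∈ ℚ(γ)ˣ`, there is a lattice
`I` of `ℚ(γ)` with `I_(q) = x_q B_(q)` for `q ∈ S` and `I_(q) = B_(q)` for the other primes. [cite: VignerasLNM800, Ch. III §5 Prop. 5.1] -/
theorem exists_glue_K (hD : ∀ x : D, x ≠ 0 → IsUnit x) (hγ : γ ∉ (⊥ : Subalgebra ℚ D))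
    (hB : IsQuadOrder γ B) (x : ℕ → Dˣ) (hx : ∀ q, (x q : D) * γ = γ * x q) (S : Finset ℕ)
    (hS : ∀ q ∈ S, q.Prime) :
    ∃ I : Submodule ℤ D, IsKLattice γ I ∧ (∀ q ∈ S, localAt q I = x q • localAt q B) ∧
      ∀ q : ℕ, q.Prime → q ∉ S → localAt q I = localAt q B := by
  classical
  induction S using Finset.induction_on with
  | empty => exact ⟨B, hB.isKLattice, fun q hq => absurd hq (Finset.notMem_empty q), fun q _ _ => rfl⟩
  | insert p S hpS ih =>
    obtain ⟨M₀, hM₀, hM₀S, hM₀out⟩ := ih fun q hq => hS q (Finset.mem_insert_of_mem hq)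
    have hp : p.Prime := hS p (Finset.mem_insert_self p S)
    haveI : Fact p.Prime := ⟨hp⟩
    set N : Submodule ℤ D := x p • localAt p B with hN
    have hNloc : localAt p N = N := by rw [hN, ← localAt_units_smul, localAt_localAt]
    have hxB : IsKLattice γ (x p • B) := hB.isKLattice.units_smul hD hγ (hx p)
    obtain ⟨r₁, hr₁⟩ := exists_pow_smul_mem_localAt_K hp hM₀.fg hM₀.le_adjoin hxB
    obtain ⟨r₂, hr₂⟩ := exists_pow_smul_mem_localAt_K hp hxB.fg hxB.le_adjoin hM₀
    have hMN : ∀ y ∈ M₀, ((p : ℤ) ^ (r₁ + r₂)) • y ∈ N := fun y hy => by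
      rw [pow_add, mul_comm, mul_smul, hN, ← localAt_units_smul]
      exact Submodule.smul_mem _ _ (hr₁ y hy)
    have hNM : ∀ y ∈ N, ((p : ℤ) ^ (r₁ + r₂)) • y ∈ localAt p M₀ := fun y hy => by
      rw [hN, ← localAt_units_smul] at hy
      obtain ⟨m, hm0, hm, hmy⟩ := hy
      rw [pow_add, mul_smul]
      refine Submodule.smul_mem _ _ ?_
      have h := hr₂ _ hmy
      rw [smul_comm] at h
      have h' := mem_localAt_of_smul_mem hm0 hm h
      rwa [localAt_localAt] at h'
    obtain ⟨M, hMp, hMq, hLM, hML⟩ :=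
      exists_localAt_eq_and_forall_localAt_eq hp M₀ N hNloc (r₁ + r₂) hMN hNM
    refine ⟨M, isKLattice_of_pow_smul hp hM₀ _ hLM hML, fun q hq => ?_, fun q hq hqS => ?_⟩
    · rcases Finset.mem_insert.mp hq with rfl | hq'
      · exact hMp
      · have hqp : q ≠ p := fun h => hpS (h ▸ hq')
        rw [hMq q (hS q hq) hqp, hM₀S q hq']
    · have hqp : q ≠ p := fun h => hqS (h ▸ Finset.mem_insert_self p S)
      rw [hMq q hq hqp, hM₀out q hq fun h => hqS (Finset.mem_insert_of_mem h)]

/-! ### The lattice of an idele -/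

/-- **Existence of the lattice `L(k)` of an idele**: `L(k)_(p) = k_p B_(p)` for every prime `p`
(glue at the finitely many primes where `k_p ∉ B_(p)ˣ`). [cite: VignerasLNM800, Ch. III §5 Thm. 5.11 (proof)] -/
theorem exists_latticeOf (hD : ∀ x : D, x ≠ 0 → IsUnit x) (hγ : γ ∉ (⊥ : Subalgebra ℚ D))
    (hB : IsQuadOrder γ B) (k : ideleGroup γ B) :
    ∃ I : Submodule ℤ D, IsKLattice γ I ∧ ∀ p : ℕ, p.Prime → localAt p I = (k : ℕ → Dˣ) p • localAt p B := by
  obtain ⟨hkγ, hfin⟩ := k.2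
  set S := hfin.toFinset with hS
  obtain ⟨I, hI, hIS, hIout⟩ := exists_glue_K hD hγ hB (k : ℕ → Dˣ) hkγ S
    (fun q hq => ((Set.Finite.mem_toFinset hfin).mp hq).1)
  refine ⟨I, hI, fun p hp => ?_⟩
  by_cases hpS : p ∈ S
  · exact hIS p hpS
  · rw [hIout p hp hpS]
    have hkp : (k : ℕ → Dˣ) p ∈ stabCentralizer (localAt p B) γ := by
      by_contra h
      exact hpS ((Set.Finite.mem_toFinset hfin).mpr ⟨hp, h⟩)
    exact hkp.1.symm

/-- **The lattice `L(k)` of an idele `k` of `ℚ(γ)`** relative to the order `B`: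
`L(k)_(p) = k_p B_(p)` for all `p`. [cite: VignerasLNM800, Ch. III §5 Thm. 5.11 (proof)] -/
def latticeOf (hD : ∀ x : D, x ≠ 0 → IsUnit x) (hγ : γ ∉ (⊥ : Subalgebra ℚ D))
    (hB : IsQuadOrder γ B) (k : ideleGroup γ B) : Submodule ℤ D :=
  Classical.choose (exists_latticeOf hD hγ hB k)

/-- `L(k)` is a lattice of `ℚ(γ)`. [folklore] -/
theorem isKLattice_latticeOf (hD : ∀ x : D, x ≠ 0 → IsUnit x) (hγ : γ ∉ (⊥ : Subalgebra ℚ D))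
    (hB : IsQuadOrder γ B) (k : ideleGroup γ B) : IsKLattice γ (latticeOf hD hγ hB k) :=
  (Classical.choose_spec (exists_latticeOf hD hγ hB k)).1

/-- **`L(k)_(p) = k_p B_(p)`.** [cite: VignerasLNM800, Ch. III §5 Thm. 5.11 (proof)] -/
theorem localAt_latticeOf (hD : ∀ x : D, x ≠ 0 → IsUnit x) (hγ : γ ∉ (⊥ : Subalgebra ℚ D))
    (hB : IsQuadOrder γ B) (k : ideleGroup γ B) {p : ℕ} (hp : p.Prime) :
    localAt p (latticeOf hD hγ hB k) = (k : ℕ → Dˣ) p • localAt p B :=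
  (Classical.choose_spec (exists_latticeOf hD hγ hB k)).2 p hp

/-- **Locally principal `B`-lattices**: `L_(p) = x_p B_(p)` with `x_p ∈ ℚ(γ)ˣ` for every
prime `p`. [cite: Cox2013, §7.A Prop. 7.4] -/
def IsLocPrin (γ : D) (B L : Submodule ℤ D) : Prop :=
  ∀ p : ℕ, p.Prime → ∃ x : Dˣ, (x : D) * γ = γ * x ∧ localAt p L = x • localAt p B

/-- `L(k)` is locally principal. [folklore] -/
theorem isLocPrin_latticeOf (hD : ∀ x : D, x ≠ 0 → IsUnit x) (hγ : γ ∉ (⊥ : Subalgebra ℚ D))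
    (hB : IsQuadOrder γ B) (k : ideleGroup γ B) : IsLocPrin γ B (latticeOf hD hγ hB k) :=
  fun p hp => ⟨(k : ℕ → Dˣ) p, k.2.1 p, localAt_latticeOf hD hγ hB k hp⟩

omit [IsQuaternionAlgebra ℚ D] [Algebra ℚ D] in
/-- Locally principal lattices are stable under `ℚ(γ)ˣ`. [folklore] -/
theorem IsLocPrin.units_smul {L : Submodule ℤ D} (hL : IsLocPrin γ B L) {c : Dˣ} (hc : (c : D) * γ = γ * c) :
    IsLocPrin γ B (c • L) := fun p hp => by
  obtain ⟨x, hx, hxL⟩ := hL p hp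
  refine ⟨c * x, ?_, ?_⟩
  · rw [Units.val_mul, mul_assoc, hx, ← mul_assoc, hc, mul_assoc]
  · rw [localAt_units_smul, hxL, smul_smul]

/-- `L(c k u) = c L(k)` for `c ∈ ℚ(γ)ˣ` and a unit idele `u`. [folklore] -/
theorem latticeOf_const_mul_mul_unit (hD : ∀ x : D, x ≠ 0 → IsUnit x) (hγ : γ ∉ (⊥ : Subalgebra ℚ D))
    (hB : IsQuadOrder γ B) {k k' : ideleGroup γ B} {c : Dˣ} {v : ideleGroup γ B}
    (hv : v ∈ unitIdeles γ B) (h : (k' : ℕ → Dˣ) = (fun _ : ℕ => c) * (k : ℕ → Dˣ) * (v : ℕ → Dˣ)) :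
    latticeOf hD hγ hB k' = c • latticeOf hD hγ hB k := by
  refine eq_iff_forall_prime_localAt_eq.mpr fun p hp => ?_
  rw [localAt_latticeOf hD hγ hB k' hp, localAt_units_smul, localAt_latticeOf hD hγ hB k hp, smul_smul, h]
  change (c * (k : ℕ → Dˣ) p * (v : ℕ → Dˣ) p) • localAt p B = _
  rw [mul_smul, (hv p hp).1]

/-- Conversely, `L(k') = c L(k)` forces `k' ∈ c k ∏ B_(p)ˣ`. [folklore] -/
theorem rel_of_latticeOf_eq (hD : ∀ x : D, x ≠ 0 → IsUnit x) (hγ : γ ∉ (⊥ : Subalgebra ℚ D))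
    (hB : IsQuadOrder γ B) {k k' : ideleGroup γ B} {c : Dˣ} (hc : (c : D) * γ = γ * c)
    (h : latticeOf hD hγ hB k' = c • latticeOf hD hγ hB k) :
    ∃ v : ideleGroup γ B, v ∈ unitIdeles γ B ∧
      (k' : ℕ → Dˣ) = (fun _ : ℕ => c) * (k : ℕ → Dˣ) * (v : ℕ → Dˣ) := by
  -- `v_p = k_p⁻¹ c⁻¹ k'_p`
  set ck : ideleGroup γ B := constIdele hD hγ hB c hc * k with hck
  have hckp : ∀ p, ((ck : ideleGroup γ B) : ℕ → Dˣ) p = c * (k : ℕ → Dˣ) p := fun p => rfl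
  refine ⟨ck⁻¹ * k', fun p hp => ?_, ?_⟩
  · refine ⟨?_, (ck⁻¹ * k').2.1 p⟩
    have e : localAt p (latticeOf hD hγ hB k') = localAt p (c • latticeOf hD hγ hB k) := by rw [h]
    rw [localAt_latticeOf hD hγ hB k' hp, localAt_units_smul, localAt_latticeOf hD hγ hB k hp,
      smul_smul] at e
    change ((((ck : ideleGroup γ B) : ℕ → Dˣ) p)⁻¹ * (k' : ℕ → Dˣ) p) • localAt p B = localAt p B
    rw [hckp, mul_smul, e, smul_smul, inv_mul_cancel, one_smul]
  · funext p
    change (k' : ℕ → Dˣ) p = c * (k : ℕ → Dˣ) p * ((((ck : ideleGroup γ B) : ℕ → Dˣ) p)⁻¹ * (k' : ℕ → Dˣ) p)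
    rw [hckp, mul_inv_cancel_left]

/-! ### Classes of lattices and the dictionary -/

/-- The locally principal `B`-lattices of `ℚ(γ)`. [cite: Cox2013, §7.A] -/
def locPrinLattices (γ : D) (B : Submodule ℤ D) : Set (Submodule ℤ D) :=
  {L | IsKLattice γ L ∧ IsLocPrin γ B L}

/-- Homothety by `ℚ(γ)ˣ` on locally principal lattices. [cite: Cox2013, §7.A] -/
def latSetoid (γ : D) (B : Submodule ℤ D) : Setoid (locPrinLattices γ B) where
  r L L' := ∃ c : Dˣ, (c : D) * γ = γ * c ∧ (L' : Submodule ℤ D) = c • (L : Submodule ℤ D)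
  iseqv :=
    { refl := fun L => ⟨1, by simp, by simp⟩
      symm := fun {L L'} ⟨c, hc, h⟩ => ⟨c⁻¹, units_inv_comm hc, by rw [h, smul_smul, inv_mul_cancel, one_smul]⟩
      trans := fun {L L' L''} ⟨c, hc, h⟩ ⟨c', hc', h'⟩ =>
        ⟨c' * c, by rw [Units.val_mul, mul_assoc, hc, ← mul_assoc, hc', mul_assoc], by rw [h', h, smul_smul]⟩ }

/-- **Classes of locally principal `B`-lattices modulo `ℚ(γ)ˣ`** (the Picard group of `B` as a
set). [cite: Cox2013, §7.A] -/
def LatClass (γ : D) (B : Submodule ℤ D) : Type u := Quotient (latSetoid γ B)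

/-- The class map `k ↦ [L(k)]`. [folklore] -/
def latClassOfIdele (hD : ∀ x : D, x ≠ 0 → IsUnit x) (hγ : γ ∉ (⊥ : Subalgebra ℚ D))
    (hB : IsQuadOrder γ B) (k : ideleGroup γ B) : LatClass γ B :=
  Quotient.mk (latSetoid γ B) ⟨latticeOf hD hγ hB k, isKLattice_latticeOf hD hγ hB k, isLocPrin_latticeOf hD hγ hB k⟩

/-- The class map is constant on idele classes. [folklore] -/
theorem latClassOfIdele_eq_of_rel (hD : ∀ x : D, x ≠ 0 → IsUnit x) (hγ : γ ∉ (⊥ : Subalgebra ℚ D))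
    (hB : IsQuadOrder γ B) {k k' : ideleGroup γ B}
    (h : (Quotient.mk (ideleClassSetoid γ B) k : IdeleClass γ B) = Quotient.mk _ k') :
    latClassOfIdele hD hγ hB k = latClassOfIdele hD hγ hB k' := by
  obtain ⟨c, v, hc, hv, e⟩ := ideleClass_mk_eq_mk_iff.mp h
  exact Quotient.sound ⟨c, hc, latticeOf_const_mul_mul_unit hD hγ hB hv e⟩

/-- **The dictionary `IdeleClass γ B → LatClass γ B`**, `[k] ↦ [L(k)]`. [cite: VignerasLNM800, Ch. III §5 Thm. 5.11 (proof)] -/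
def ideleClassToLatClass (hD : ∀ x : D, x ≠ 0 → IsUnit x) (hγ : γ ∉ (⊥ : Subalgebra ℚ D))
    (hB : IsQuadOrder γ B) : IdeleClass γ B → LatClass γ B :=
  Quotient.lift (latClassOfIdele hD hγ hB) fun _ _ h => latClassOfIdele_eq_of_rel hD hγ hB (Quotient.sound h)

/-- The dictionary is injective. [folklore] -/
theorem ideleClassToLatClass_injective (hD : ∀ x : D, x ≠ 0 → IsUnit x)
    (hγ : γ ∉ (⊥ : Subalgebra ℚ D)) (hB : IsQuadOrder γ B) :
    Function.Injective (ideleClassToLatClass hD hγ hB) := by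
  intro x y hxy
  induction x using Quotient.inductionOn with
  | h k =>
  induction y using Quotient.inductionOn with
  | h k' =>
  obtain ⟨c, hc, e⟩ := Quotient.exact hxy
  obtain ⟨v, hv, hkk'⟩ := rel_of_latticeOf_eq hD hγ hB hc e
  exact Quotient.sound ⟨c, v, hc, hv, hkk'⟩

/-- **Every locally principal lattice is some `L(k)`**: take `k_p = 1` where `L_(p) = B_(p)`
(almost everywhere) and `k_p = x_p` with `L_(p) = x_p B_(p)` elsewhere. [cite: VignerasLNM800, Ch. III §5 Thm. 5.11 (proof)] -/
theorem exists_latticeOf_eq (hD : ∀ x : D, x ≠ 0 → IsUnit x) (hγ : γ ∉ (⊥ : Subalgebra ℚ D))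
    (hB : IsQuadOrder γ B) {L : Submodule ℤ D} (hL : IsKLattice γ L) (hLP : IsLocPrin γ B L) :
    ∃ k : ideleGroup γ B, latticeOf hD hγ hB k = L := by
  classical
  let k₀ : ℕ → Dˣ := fun p =>
    if hp : p.Prime then (if localAt p L = localAt p B then 1 else (hLP p hp).choose) else 1
  have hk₀γ : ∀ p, (k₀ p : D) * γ = γ * k₀ p := by
    intro p
    by_cases hp : p.Prime
    · by_cases he : localAt p L = localAt p B
      · simp [k₀, hp, he]
      · simp only [k₀, hp, he, dif_pos, if_false]
        exact (hLP p hp).choose_spec.1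
    · simp [k₀, hp]
  have hk₀L : ∀ p, p.Prime → localAt p L = k₀ p • localAt p B := by
    intro p hp
    by_cases he : localAt p L = localAt p B
    · simp [k₀, hp, he]
    · simp only [k₀, hp, he, dif_pos, if_false]
      exact (hLP p hp).choose_spec.2
  have hfin : {p : ℕ | p.Prime ∧ k₀ p ∉ stabCentralizer (localAt p B) γ}.Finite := by
    refine (IsQuadOrder.finite_setOf_localAt_ne_of_full hL.full hL.fg hL.le_adjoin hB.full hB.fg
      hB.le_adjoin).subset ?_
    rintro p ⟨hp, hk⟩
    refine ⟨hp, fun he => hk ?_⟩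
    have : k₀ p = 1 := by simp [k₀, hp, he]
    rw [this]
    exact Subgroup.one_mem _
  refine ⟨⟨k₀, hk₀γ, hfin⟩, eq_iff_forall_prime_localAt_eq.mpr fun p hp => ?_⟩
  rw [localAt_latticeOf hD hγ hB _ hp, hk₀L p hp]

/-- The dictionary is surjective. [folklore] -/
theorem ideleClassToLatClass_surjective (hD : ∀ x : D, x ≠ 0 → IsUnit x)
    (hγ : γ ∉ (⊥ : Subalgebra ℚ D)) (hB : IsQuadOrder γ B) :
    Function.Surjective (ideleClassToLatClass hD hγ hB) := by
  intro x
  induction x using Quotient.inductionOn with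
  | h L =>
  obtain ⟨k, hk⟩ := exists_latticeOf_eq hD hγ hB L.2.1 L.2.2
  refine ⟨Quotient.mk _ k, ?_⟩
  change latClassOfIdele hD hγ hB k = _
  unfold latClassOfIdele
  congr 1
  exact Subtype.ext hk

/-- **`IdeleClass γ B ≃ LatClass γ B`**: idele classes of `ℚ(γ)` relative to `B` are the classes
of locally principal `B`-lattices modulo `ℚ(γ)ˣ`. [cite: VignerasLNM800, Ch. III §5 Thm. 5.11 (proof); Cox2013, §7.C] -/
def ideleClassEquivLatClass (hD : ∀ x : D, x ≠ 0 → IsUnit x) (hγ : γ ∉ (⊥ : Subalgebra ℚ D))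
    (hB : IsQuadOrder γ B) : IdeleClass γ B ≃ LatClass γ B :=
  Equiv.ofBijective _ ⟨ideleClassToLatClass_injective hD hγ hB, ideleClassToLatClass_surjective hD hγ hB⟩

/-- **`h(B) = #LatClass γ B`.** [cite: Cox2013, §7.C (Pic(𝒪) = C(𝒪))] -/
theorem classNumber_eq_card_latClass (hD : ∀ x : D, x ≠ 0 → IsUnit x) (hγ : γ ∉ (⊥ : Subalgebra ℚ D))
    (hB : IsQuadOrder γ B) : classNumber γ B = Nat.card (LatClass γ B) :=
  Nat.card_congr (ideleClassEquivLatClass hD hγ hB)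

end Brandt

end Literature.NumberTheory.Automorphic

end
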